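import Mathlib
import HarnessLib
import Summits.NavierStokesRegularity.NavierStokesRegularity.Theorems.PoloidalWindowDoorPoloidalWindowRigidityHorizontalMean

/-!
# Crux K2 `PoloidalWindowRigidity` (stmt-NavierStokesRegularity-19708), line `z_shock` — R3 infrastructure: the SLICE-TYPING
# DICTIONARY between the stubs' `ℝ³`-vocabulary (height = coordinate `2`, nested `fderiv` along `EuclideanSpace.single _ 1`) and the
# `(s, y) ∈ ℝ × ℝ²` typing of the height-evolution files (`…ZShockLocalEnergy`, `…ZShockWaveLocalEnergy`)

`--supports stmt-NavierStokesRegularity-19708 --as helper` (leafhand-ns-poloidalwindowdoor-3 g6, cell decomp-ns, 2026-08-31).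
**No stub and no summit is closed by this file; Navier–Stokes regularity is NOT proved here (rung 0).**

WHY THIS FILE.  The deciding stub `stub_zShockThickAut` of `Cruxes/PoloidalWindowRigidity/Lines/z_shock.lean` and its typed entrance
`…ZShockHeightEvolution.heightEvolution_of_class_autonomy` speak about ONE function on `ℝ³` — the slice `x ↦ v t₀ x` (or its height
component `w = v t₀ · 2`) — with the height as the coordinate `2` and all derivatives written as (nested) `fderiv ℝ _ x (EuclideanSpace.single b 1)`.
The R3 infrastructure landed by hands 3-g4/3-g5 (wave-energy balance, local energy inequality, domain of dependence) is written in the natural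
typing of an evolution equation: a field `W : ℝ → EuclideanSpace ℝ (Fin 2) → ℝ` of the height `s` and the horizontal variable `y`, with `deriv`
in `s` and `fderiv` in `y`, the equation in the DIVERGENCE form
`∂ₛ∂ₛW = Σᵢ ∂ᵢ(γ(W) ∂ᵢW)`.  Hand 3-g5 named the glue between the two vocabularies as the first remaining packaging item for an R3 lead
(exit report 2026-08-31T15:11Z).  This file is that glue, on the tree's slice chart `pt c 1 s y = c + hor y + s·e₂` of
`…HorizontalMean` (base point `c ∈ ℝ³`, horizontal embedding `hor : ℝ² →L ℝ³`):

* the chart is jointly smooth (`contDiff_pt_uncurry`), so `(s, y) ↦ u (pt c 1 s y)` is jointly `Cⁿ` when `u` is (`contDiff_slice_uncurry`);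
* FIRST-ORDER DICTIONARY: `∂ₛ[u ∘ chart] = ∂₂u`, `∂_{y_b}[u ∘ chart] = ∂_b u` (`b = 0, 1`) — `hasDerivAt_slice_height`, `deriv_slice_height`,
  `hasFDerivAt_slice_horizontal`, `fderiv_slice_horizontal`, and the vector-field forms `deriv_slice_height_field`,
  `fderiv_slice_horizontal_field` (`(fderiv ℝ v x h) 2 = fderiv ℝ (v · 2) x h`);
* SECOND-ORDER DICTIONARY (`u ∈ C²`): `∂ₛ∂ₛ`, `∂_{y_b'}∂_{y_b}`, `∂_{y_b}∂ₛ` of the slice field are the stubs' nested second derivatives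
  `∂₂∂₂u`, `∂_{b'}∂_b u`, `∂_b∂₂u` at the chart point (`deriv_deriv_slice_height`, `fderiv_fderiv_slice_horizontal`, `fderiv_deriv_slice`);
* PDE TRANSFER: the conclusion of `…ZShockHeightEvolution.heightEvolution_of_slope_function` /
  `heightEvolution_of_class_autonomy` at a point `x = pt c 1 s y`,
  `∂₂∂₂u = −( G(u)(∂₀∂₀u + ∂₁∂₁u) + G'(u)((∂₀u)² + (∂₁u)²) )`,
  is EXACTLY the hypothesis `hpde` of `…ZShockWaveLocalEnergy.waveEnergy_balance` / `static_of_static_data` at `(s, y)` for the slice field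
  `W s y = u (pt c 1 s y)` and `γ = −G`: `∂ₛ∂ₛW = Σᵢ ∂ᵢ(γ(W) ∂ᵢW)` (`slice_wave_pde`, and `slice_wave_pde_field` for `u = v · 2` in the
  vector-field vocabulary of the stubs);
* HEIGHT REVERSAL (the «two-sided» remark of 3-g5): the reflected slice `s ↦ W (−s)` has the same horizontal derivatives, the opposite height
  derivative and the same second height derivative, so it solves the same (autonomous, second-order-in-`s`) equation
  (`deriv_slice_height_reflect`, `deriv_deriv_slice_height_reflect`, `slice_wave_pde_reflect`): every one-sided statement of the
  `(s, y)` files holds towards decreasing height as well.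

Elementary (chain rule on an affine chart, product rule); Mathlib + `…HorizontalMean` only.  It proves no rigidity.  presearch: none needed
(calculus bookkeeping); tree: `…HorizontalMean.hasFDerivAt_pt` / `hasDerivAt_pt_height` are the chart derivatives used. [folklore]
-/

noncomputable section

namespace Summit.NavierStokesRegularity.NavierStokesRegularity.Theorems.PoloidalWindowDoorPoloidalWindowRigidityZShockSliceTyping

-- the problem directory repeats the summit name (`NavierStokesRegularity/NavierStokesRegularity`)
set_option linter.dupNamespace false

open Set Function
open scoped ContDiff
open Summit.NavierStokesRegularity.NavierStokesRegularity.Theorems.PoloidalWindowDoorPoloidalWindowRigidityHorizontalMean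

/-! ### The slice chart -/

/-- The slice chart with unit scale: `pt c 1 s y = c + hor y + s·e₂`. [folklore] -/
theorem pt_one (c : EuclideanSpace ℝ (Fin 3)) (s : ℝ) (y : EuclideanSpace ℝ (Fin 2)) :
    pt c 1 s y = c + hor y + s • EuclideanSpace.single (2 : Fin 3) (1 : ℝ) := by
  simp [pt]

/-- The slice chart `(s, y) ↦ pt c 1 s y` is jointly smooth (it is affine). [folklore] -/
theorem contDiff_pt_uncurry (c : EuclideanSpace ℝ (Fin 3)) {n : WithTop ℕ∞} :
    ContDiff ℝ n (fun p : ℝ × EuclideanSpace ℝ (Fin 2) => pt c 1 p.1 p.2) := by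
  unfold pt
  fun_prop

/-- `Fin.castSucc 0 = 0` from `Fin 2` to `Fin 3`. [folklore] -/
theorem castSucc_zero_two : (Fin.castSucc (0 : Fin 2) : Fin 3) = 0 := rfl

/-- `Fin.castSucc 1 = 1` from `Fin 2` to `Fin 3`. [folklore] -/
theorem castSucc_one_two : (Fin.castSucc (1 : Fin 2) : Fin 3) = 1 := rfl

/-! ### First-order dictionary for a scalar function on `ℝ³` -/

section Scalar

variable {u : EuclideanSpace ℝ (Fin 3) → ℝ} {c : EuclideanSpace ℝ (Fin 3)} {s : ℝ} {y : EuclideanSpace ℝ (Fin 2)}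

/-- **Height derivative of the slice field = `∂₂u`.**  If `u` is differentiable at the chart point, then
`s' ↦ u (pt c 1 s' y)` has derivative `fderiv u (pt c 1 s y) e₂` at `s`. [folklore] -/
theorem hasDerivAt_slice_height (hu : DifferentiableAt ℝ u (pt c 1 s y)) :
    HasDerivAt (fun s' => u (pt c 1 s' y)) (fderiv ℝ u (pt c 1 s y) (EuclideanSpace.single (2 : Fin 3) (1 : ℝ))) s :=
  hu.hasFDerivAt.comp_hasDerivAt s (hasDerivAt_pt_height c 1 s y)

/-- `deriv` form of `hasDerivAt_slice_height`. [folklore] -/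
theorem deriv_slice_height (hu : DifferentiableAt ℝ u (pt c 1 s y)) :
    deriv (fun s' => u (pt c 1 s' y)) s = fderiv ℝ u (pt c 1 s y) (EuclideanSpace.single (2 : Fin 3) (1 : ℝ)) :=
  (hasDerivAt_slice_height hu).deriv

/-- The height line of the slice field is differentiable where `u` is. [folklore] -/
theorem differentiableAt_slice_height (hu : DifferentiableAt ℝ u (pt c 1 s y)) :
    DifferentiableAt ℝ (fun s' => u (pt c 1 s' y)) s :=
  (hasDerivAt_slice_height hu).differentiableAt

/-- **Horizontal derivative of the slice field.**  If `u` is differentiable at the chart point, then `y' ↦ u (pt c 1 s y')` has Fréchet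
derivative `fderiv u (pt c 1 s y) ∘ hor` at `y`. [folklore] -/
theorem hasFDerivAt_slice_horizontal (hu : DifferentiableAt ℝ u (pt c 1 s y)) :
    HasFDerivAt (fun y' => u (pt c 1 s y')) ((fderiv ℝ u (pt c 1 s y)).comp ((1 : ℝ) • hor)) y :=
  hu.hasFDerivAt.comp y (hasFDerivAt_pt c 1 s y)

/-- The horizontal slice of the slice field is differentiable where `u` is. [folklore] -/
theorem differentiableAt_slice_horizontal (hu : DifferentiableAt ℝ u (pt c 1 s y)) :
    DifferentiableAt ℝ (fun y' => u (pt c 1 s y')) y :=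
  (hasFDerivAt_slice_horizontal hu).differentiableAt

/-- **Horizontal partial derivatives of the slice field = `∂_b u`** (`b = 0, 1`, cast into `Fin 3`). [folklore] -/
theorem fderiv_slice_horizontal (hu : DifferentiableAt ℝ u (pt c 1 s y)) (b : Fin 2) :
    fderiv ℝ (fun y' => u (pt c 1 s y')) y (EuclideanSpace.single b (1 : ℝ)) =
      fderiv ℝ u (pt c 1 s y) (EuclideanSpace.single (Fin.castSucc b) (1 : ℝ)) := by
  rw [(hasFDerivAt_slice_horizontal hu).fderiv, ContinuousLinearMap.comp_apply, smul_apply, one_smul,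
    hor_single]

/-- The slice field of a `Cⁿ` function is jointly `Cⁿ` in `(s, y)`. [folklore] -/
theorem contDiff_slice_uncurry {n : WithTop ℕ∞} (hu : ContDiff ℝ n u) (c : EuclideanSpace ℝ (Fin 3)) :
    ContDiff ℝ n (uncurry fun s y => u (pt c 1 s y)) :=
  hu.comp (contDiff_pt_uncurry c)

/-! ### Second-order dictionary (`u ∈ C²`) -/

/-- A `C²` function is differentiable. [folklore] -/
theorem differentiable_of_contDiff_two (hu : ContDiff ℝ 2 u) : Differentiable ℝ u :=
  hu.differentiable (by norm_num)

/-- The directional derivative `x ↦ ∂ₕu(x)` of a `C²` function is differentiable. [folklore] -/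
theorem differentiable_fderiv_apply_of_contDiff_two (hu : ContDiff ℝ 2 u) (h : EuclideanSpace ℝ (Fin 3)) :
    Differentiable ℝ (fun x => fderiv ℝ u x h) :=
  ((hu.fderiv_right (m := 1) (by norm_num)).differentiable (by norm_num)).clm_apply (differentiable_const h)

/-- **Second height derivative of the slice field = `∂₂∂₂u`** (nested form, as in the stubs). [folklore] -/
theorem deriv_deriv_slice_height (hu : ContDiff ℝ 2 u) :
    deriv (fun s' => deriv (fun s'' => u (pt c 1 s'' y)) s') s =
      fderiv ℝ (fun x => fderiv ℝ u x (EuclideanSpace.single (2 : Fin 3) (1 : ℝ))) (pt c 1 s y)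
        (EuclideanSpace.single (2 : Fin 3) (1 : ℝ)) := by
  have hd := differentiable_of_contDiff_two hu
  have h1 : (fun s' => deriv (fun s'' => u (pt c 1 s'' y)) s') =
      fun s' => (fun x => fderiv ℝ u x (EuclideanSpace.single (2 : Fin 3) (1 : ℝ))) (pt c 1 s' y) := by
    funext s'
    exact deriv_slice_height (hd _)
  rw [h1]
  exact deriv_slice_height (differentiable_fderiv_apply_of_contDiff_two hu _ _)

/-- **Second horizontal derivatives of the slice field = `∂_{b'}∂_b u`** (nested form). [folklore] -/
theorem fderiv_fderiv_slice_horizontal (hu : ContDiff ℝ 2 u) (b b' : Fin 2) :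
    fderiv ℝ (fun y' => fderiv ℝ (fun y'' => u (pt c 1 s y'')) y' (EuclideanSpace.single b (1 : ℝ))) y
        (EuclideanSpace.single b' (1 : ℝ)) =
      fderiv ℝ (fun x => fderiv ℝ u x (EuclideanSpace.single (Fin.castSucc b) (1 : ℝ))) (pt c 1 s y)
        (EuclideanSpace.single (Fin.castSucc b') (1 : ℝ)) := by
  have hd := differentiable_of_contDiff_two hu
  have h1 : (fun y' => fderiv ℝ (fun y'' => u (pt c 1 s y'')) y' (EuclideanSpace.single b (1 : ℝ))) =
      fun y' => (fun x => fderiv ℝ u x (EuclideanSpace.single (Fin.castSucc b) (1 : ℝ))) (pt c 1 s y') := by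
    funext y'
    exact fderiv_slice_horizontal (hd _) b
  rw [h1]
  exact fderiv_slice_horizontal (differentiable_fderiv_apply_of_contDiff_two hu _ _) b'

/-- **Mixed derivative: horizontal derivative of the height derivative = `∂_b∂₂u`** (nested form; the quantity entering the stubs' twist
bracket `∂₀(∂₂w)∂₁w − ∂₁(∂₂w)∂₀w`). [folklore] -/
theorem fderiv_deriv_slice (hu : ContDiff ℝ 2 u) (b : Fin 2) :
    fderiv ℝ (fun y' => deriv (fun s' => u (pt c 1 s' y')) s) y (EuclideanSpace.single b (1 : ℝ)) =
      fderiv ℝ (fun x => fderiv ℝ u x (EuclideanSpace.single (2 : Fin 3) (1 : ℝ))) (pt c 1 s y)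
        (EuclideanSpace.single (Fin.castSucc b) (1 : ℝ)) := by
  have hd := differentiable_of_contDiff_two hu
  have h1 : (fun y' => deriv (fun s' => u (pt c 1 s' y')) s) =
      fun y' => (fun x => fderiv ℝ u x (EuclideanSpace.single (2 : Fin 3) (1 : ℝ))) (pt c 1 s y') := by
    funext y'
    exact deriv_slice_height (hd _)
  rw [h1]
  exact fderiv_slice_horizontal (differentiable_fderiv_apply_of_contDiff_two hu _ _) b

/-- **Mixed derivative: height derivative of a horizontal derivative = `∂₂∂_b u`** (nested form). [folklore] -/
theorem deriv_fderiv_slice (hu : ContDiff ℝ 2 u) (b : Fin 2) :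
    deriv (fun s' => fderiv ℝ (fun y' => u (pt c 1 s' y')) y (EuclideanSpace.single b (1 : ℝ))) s =
      fderiv ℝ (fun x => fderiv ℝ u x (EuclideanSpace.single (Fin.castSucc b) (1 : ℝ))) (pt c 1 s y)
        (EuclideanSpace.single (2 : Fin 3) (1 : ℝ)) := by
  have hd := differentiable_of_contDiff_two hu
  have h1 : (fun s' => fderiv ℝ (fun y' => u (pt c 1 s' y')) y (EuclideanSpace.single b (1 : ℝ))) =
      fun s' => (fun x => fderiv ℝ u x (EuclideanSpace.single (Fin.castSucc b) (1 : ℝ))) (pt c 1 s' y) := by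
    funext s'
    exact fderiv_slice_horizontal (hd _) b
  rw [h1]
  exact deriv_slice_height (differentiable_fderiv_apply_of_contDiff_two hu _ _)

/-! ### PDE transfer: the height-evolution in the stubs' vocabulary is the divergence-form equation of the `(s, y)` files -/

/-- One term of the divergence form: `∂_{y_i}[ γ(W) ∂_{y_i}W ](s, y) = −G(u)·∂_i∂_i u − G'(u)·(∂_i u)²` at the chart point, for
`W s y = u (pt c 1 s y)`, `γ = −G`, `u ∈ C²`, `G` differentiable at the value. [folklore] -/
theorem fderiv_flux_term (hu : ContDiff ℝ 2 u) {G : ℝ → ℝ} {G' : ℝ} (hG : HasDerivAt G G' (u (pt c 1 s y))) (i : Fin 2) :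
    fderiv ℝ (fun y' => -G (u (pt c 1 s y')) * fderiv ℝ (fun y'' => u (pt c 1 s y'')) y' (EuclideanSpace.single i (1 : ℝ))) y
        (EuclideanSpace.single i (1 : ℝ)) =
      -G (u (pt c 1 s y)) *
          fderiv ℝ (fun x => fderiv ℝ u x (EuclideanSpace.single (Fin.castSucc i) (1 : ℝ))) (pt c 1 s y)
            (EuclideanSpace.single (Fin.castSucc i) (1 : ℝ)) -
        G' * fderiv ℝ u (pt c 1 s y) (EuclideanSpace.single (Fin.castSucc i) (1 : ℝ)) ^ 2 := by
  have hd := differentiable_of_contDiff_two hu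
  -- the first factor `y' ↦ -G (u (pt c 1 s y'))`
  have hA : HasFDerivAt (fun y' => -G (u (pt c 1 s y')))
      (-(G' • (fderiv ℝ u (pt c 1 s y)).comp ((1 : ℝ) • hor))) y :=
    (hG.comp_hasFDerivAt y (hasFDerivAt_slice_horizontal (hd _))).neg
  -- the second factor `y' ↦ ∂_{y_i}W (s, y') = ∂_i u (pt c 1 s y')`
  have hB1 : (fun y' => fderiv ℝ (fun y'' => u (pt c 1 s y'')) y' (EuclideanSpace.single i (1 : ℝ))) =
      fun y' => (fun x => fderiv ℝ u x (EuclideanSpace.single (Fin.castSucc i) (1 : ℝ))) (pt c 1 s y') := by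
    funext y'
    exact fderiv_slice_horizontal (hd _) i
  have hdi := differentiable_fderiv_apply_of_contDiff_two hu (EuclideanSpace.single (Fin.castSucc i) (1 : ℝ))
  have hB : HasFDerivAt (fun y' => fderiv ℝ (fun y'' => u (pt c 1 s y'')) y' (EuclideanSpace.single i (1 : ℝ)))
      ((fderiv ℝ (fun x => fderiv ℝ u x (EuclideanSpace.single (Fin.castSucc i) (1 : ℝ))) (pt c 1 s y)).comp
        ((1 : ℝ) • hor)) y := by
    rw [hB1]
    exact hasFDerivAt_slice_horizontal (hdi _)
  have hprod : HasFDerivAt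
      (fun y' => -G (u (pt c 1 s y')) * fderiv ℝ (fun y'' => u (pt c 1 s y'')) y' (EuclideanSpace.single i (1 : ℝ)))
      (-G (u (pt c 1 s y)) •
          (fderiv ℝ (fun x => fderiv ℝ u x (EuclideanSpace.single (Fin.castSucc i) (1 : ℝ))) (pt c 1 s y)).comp
            ((1 : ℝ) • hor) +
        fderiv ℝ (fun y'' => u (pt c 1 s y'')) y (EuclideanSpace.single i (1 : ℝ)) •
          -(G' • (fderiv ℝ u (pt c 1 s y)).comp ((1 : ℝ) • hor))) y :=
    hA.mul hB
  rw [hprod.fderiv]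
  simp only [add_apply, smul_apply, neg_apply,
    ContinuousLinearMap.comp_apply, one_smul, hor_single, smul_eq_mul]
  rw [fderiv_slice_horizontal (hd _) i]
  ring

/-- **PDE TRANSFER (scalar form).**  Let `u : ℝ³ → ℝ` be `C²`, `G` differentiable at the value `u(x)` with derivative `G'`, `x = pt c 1 s y`,
and suppose the autonomous height-evolution holds at `x` in the nested `ℝ³`-vocabulary of `…ZShockHeightEvolution`:
`∂₂∂₂u = −( G(u)(∂₀∂₀u + ∂₁∂₁u) + G'·((∂₀u)² + (∂₁u)²) )`.  Then the slice field `W s y = u (pt c 1 s y)` satisfies at `(s, y)` the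
divergence-form equation of `…ZShockWaveLocalEnergy` with `γ = −G`:
`∂ₛ∂ₛW = Σᵢ ∂_{y_i}[ γ(W) ∂_{y_i}W ]`. [folklore] -/
theorem slice_wave_pde (hu : ContDiff ℝ 2 u) {G : ℝ → ℝ} {G' : ℝ} (hG : HasDerivAt G G' (u (pt c 1 s y)))
    (hpde : fderiv ℝ (fun x => fderiv ℝ u x (EuclideanSpace.single (2 : Fin 3) (1 : ℝ))) (pt c 1 s y)
        (EuclideanSpace.single (2 : Fin 3) (1 : ℝ)) =
      -(G (u (pt c 1 s y)) *
            (fderiv ℝ (fun x => fderiv ℝ u x (EuclideanSpace.single (0 : Fin 3) (1 : ℝ))) (pt c 1 s y)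
                (EuclideanSpace.single (0 : Fin 3) (1 : ℝ)) +
              fderiv ℝ (fun x => fderiv ℝ u x (EuclideanSpace.single (1 : Fin 3) (1 : ℝ))) (pt c 1 s y)
                (EuclideanSpace.single (1 : Fin 3) (1 : ℝ))) +
          G' * (fderiv ℝ u (pt c 1 s y) (EuclideanSpace.single (0 : Fin 3) (1 : ℝ)) ^ 2 +
            fderiv ℝ u (pt c 1 s y) (EuclideanSpace.single (1 : Fin 3) (1 : ℝ)) ^ 2))) :
    deriv (fun s' => deriv (fun s'' => u (pt c 1 s'' y)) s') s =
      ∑ i : Fin 2, fderiv ℝ (fun y' => -G (u (pt c 1 s y')) *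
          fderiv ℝ (fun y'' => u (pt c 1 s y'')) y' (EuclideanSpace.single i (1 : ℝ))) y (EuclideanSpace.single i (1 : ℝ)) := by
  rw [deriv_deriv_slice_height hu, hpde, Fin.sum_univ_two, fderiv_flux_term hu hG 0, fderiv_flux_term hu hG 1,
    castSucc_zero_two, castSucc_one_two]
  ring

end Scalar

/-! ### The same dictionary in the vector-field vocabulary of the stubs (`w = v · 2`) -/

section Field

variable {v : EuclideanSpace ℝ (Fin 3) → EuclideanSpace ℝ (Fin 3)} {c : EuclideanSpace ℝ (Fin 3)} {s : ℝ}
  {y : EuclideanSpace ℝ (Fin 2)}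

/-- Components of the Fréchet derivative of a vector field: `(Dv(x) h)₂ = D(v·2)(x) h`. [folklore] -/
theorem fderiv_apply_two {x : EuclideanSpace ℝ (Fin 3)} (hv : DifferentiableAt ℝ v x) (h : EuclideanSpace ℝ (Fin 3)) :
    fderiv ℝ v x h 2 = fderiv ℝ (fun x' => v x' 2) x h := by
  have hc : (fun x' => v x' 2) = (EuclideanSpace.proj (𝕜 := ℝ) (2 : Fin 3)) ∘ v := rfl
  rw [hc, ((EuclideanSpace.proj (𝕜 := ℝ) (2 : Fin 3)).hasFDerivAt.comp x hv.hasFDerivAt).fderiv]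
  rfl

/-- The height component of a `Cⁿ` vector field is `Cⁿ`. [folklore] -/
theorem contDiff_apply_two {n : WithTop ℕ∞} (hv : ContDiff ℝ n v) : ContDiff ℝ n (fun x => v x 2) :=
  (EuclideanSpace.proj (𝕜 := ℝ) (2 : Fin 3)).contDiff.comp hv

/-- **Height derivative of `w = v·2` along the slice = the stubs' `(fderiv ℝ v x e₂) 2`.** [folklore] -/
theorem deriv_slice_height_field (hv : DifferentiableAt ℝ v (pt c 1 s y)) :
    deriv (fun s' => v (pt c 1 s' y) 2) s = fderiv ℝ v (pt c 1 s y) (EuclideanSpace.single (2 : Fin 3) (1 : ℝ)) 2 := by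
  rw [fderiv_apply_two hv]
  exact deriv_slice_height (u := fun x => v x 2)
    (((EuclideanSpace.proj (𝕜 := ℝ) (2 : Fin 3)).differentiableAt).comp _ hv)

/-- **Horizontal derivatives of `w = v·2` along the slice = the stubs' `(fderiv ℝ v x e_b) 2`** (`b = 0, 1`). [folklore] -/
theorem fderiv_slice_horizontal_field (hv : DifferentiableAt ℝ v (pt c 1 s y)) (b : Fin 2) :
    fderiv ℝ (fun y' => v (pt c 1 s y') 2) y (EuclideanSpace.single b (1 : ℝ)) =
      fderiv ℝ v (pt c 1 s y) (EuclideanSpace.single (Fin.castSucc b) (1 : ℝ)) 2 := by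
  rw [fderiv_apply_two hv]
  exact fderiv_slice_horizontal (u := fun x => v x 2)
    (((EuclideanSpace.proj (𝕜 := ℝ) (2 : Fin 3)).differentiableAt).comp _ hv) b

/-- **PDE TRANSFER (vector-field form).**  For a `C²` field `v : ℝ³ → ℝ³` and `G` differentiable at the value `v(x)·2` (`x = pt c 1 s y`),
the conclusion of `…ZShockHeightEvolution.heightEvolution_of_slope_function` / `heightEvolution_of_class_autonomy` at `x` — written, as
there, with the height component taken AFTER the Fréchet derivative — gives the divergence-form equation of `…ZShockWaveLocalEnergy` at
`(s, y)` for the slice field `W s y = v (pt c 1 s y) 2` and `γ = −G`. [folklore] -/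
theorem slice_wave_pde_field (hv : ContDiff ℝ 2 v) {G : ℝ → ℝ} {G' : ℝ} (hG : HasDerivAt G G' (v (pt c 1 s y) 2))
    (hpde : fderiv ℝ (fun x => fderiv ℝ v x (EuclideanSpace.single (2 : Fin 3) (1 : ℝ)) 2) (pt c 1 s y)
        (EuclideanSpace.single (2 : Fin 3) (1 : ℝ)) =
      -(G (v (pt c 1 s y) 2) *
            (fderiv ℝ (fun x => fderiv ℝ v x (EuclideanSpace.single (0 : Fin 3) (1 : ℝ)) 2) (pt c 1 s y)
                (EuclideanSpace.single (0 : Fin 3) (1 : ℝ)) +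
              fderiv ℝ (fun x => fderiv ℝ v x (EuclideanSpace.single (1 : Fin 3) (1 : ℝ)) 2) (pt c 1 s y)
                (EuclideanSpace.single (1 : Fin 3) (1 : ℝ))) +
          G' * (fderiv ℝ v (pt c 1 s y) (EuclideanSpace.single (0 : Fin 3) (1 : ℝ)) 2 ^ 2 +
            fderiv ℝ v (pt c 1 s y) (EuclideanSpace.single (1 : Fin 3) (1 : ℝ)) 2 ^ 2))) :
    deriv (fun s' => deriv (fun s'' => v (pt c 1 s'' y) 2) s') s =
      ∑ i : Fin 2, fderiv ℝ (fun y' => -G (v (pt c 1 s y') 2) *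
          fderiv ℝ (fun y'' => v (pt c 1 s y'') 2) y' (EuclideanSpace.single i (1 : ℝ))) y (EuclideanSpace.single i (1 : ℝ)) := by
  have hd : Differentiable ℝ v := hv.differentiable (by norm_num)
  have hcoord : ∀ h : EuclideanSpace ℝ (Fin 3), (fun x => fderiv ℝ v x h 2) = fun x => fderiv ℝ (fun x' => v x' 2) x h := by
    intro h
    funext x
    exact fderiv_apply_two (hd x) h
  rw [hcoord, hcoord, hcoord, fderiv_apply_two (hd _), fderiv_apply_two (hd _)] at hpde
  exact slice_wave_pde (contDiff_apply_two hv) hG hpde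

end Field

/-! ### Height reversal: the `(s, y)` statements hold towards decreasing height as well -/

section Reflect

variable {W : ℝ → EuclideanSpace ℝ (Fin 2) → ℝ} {s : ℝ} {y : EuclideanSpace ℝ (Fin 2)}

/-- Height derivative of the reflected field `s ↦ W (−s) y`: `−∂ₛW(−s, y)`. [folklore] -/
theorem deriv_slice_height_reflect (W : ℝ → EuclideanSpace ℝ (Fin 2) → ℝ) (s : ℝ) (y : EuclideanSpace ℝ (Fin 2)) :
    deriv (fun s' => W (-s') y) s = -deriv (fun s' => W s' y) (-s) := by
  have h := deriv_comp_neg (fun s' => W s' y) s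
  simpa using h

/-- Second height derivative of the reflected field: `∂ₛ∂ₛ[W(−·)](s) = ∂ₛ∂ₛW(−s)`. [folklore] -/
theorem deriv_deriv_slice_height_reflect (W : ℝ → EuclideanSpace ℝ (Fin 2) → ℝ) (s : ℝ) (y : EuclideanSpace ℝ (Fin 2)) :
    deriv (fun s' => deriv (fun s'' => W (-s'') y) s') s = deriv (fun s' => deriv (fun s'' => W s'' y) s') (-s) := by
  have h1 : (fun s' => deriv (fun s'' => W (-s'') y) s') = fun s' => -deriv (fun s'' => W s'' y) (-s') := by
    funext s'
    exact deriv_slice_height_reflect W s' y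
  rw [h1, deriv.fun_neg, deriv_comp_neg (fun s' => deriv (fun s'' => W s'' y) s') s, neg_neg]

/-- The reflected field is jointly smooth when the field is. [folklore] -/
theorem contDiff_uncurry_reflect {n : WithTop ℕ∞} (hW : ContDiff ℝ n (uncurry W)) :
    ContDiff ℝ n (uncurry fun s y => W (-s) y) := by
  have h : (uncurry fun s y => W (-s) y) = uncurry W ∘ fun p : ℝ × EuclideanSpace ℝ (Fin 2) => (-p.1, p.2) := by
    funext p
    rfl
  rw [h]
  exact hW.comp (by fun_prop)

/-- **HEIGHT REVERSAL of the divergence-form equation.**  If `W` solves `∂ₛ∂ₛW = Σᵢ ∂ᵢ(γ(W)∂ᵢW)` at `(−s, y)`, then the reflected field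
`(s, y) ↦ W (−s) y` solves the same equation at `(s, y)` (the equation is autonomous and second order in the height). [folklore] -/
theorem slice_wave_pde_reflect {γ : ℝ → ℝ}
    (hpde : deriv (fun s' => deriv (fun s'' => W s'' y) s') (-s) =
      ∑ i : Fin 2, fderiv ℝ (fun y' => γ (W (-s) y') * fderiv ℝ (W (-s)) y' (EuclideanSpace.single i (1 : ℝ))) y
        (EuclideanSpace.single i (1 : ℝ))) :
    deriv (fun s' => deriv (fun s'' => (fun t z => W (-t) z) s'' y) s') s =
      ∑ i : Fin 2, fderiv ℝ (fun y' => γ ((fun t z => W (-t) z) s y') *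
          fderiv ℝ ((fun t z => W (-t) z) s) y' (EuclideanSpace.single i (1 : ℝ))) y (EuclideanSpace.single i (1 : ℝ)) := by
  simp only []
  rw [deriv_deriv_slice_height_reflect W s y, hpde]

end Reflect

end Summit.NavierStokesRegularity.NavierStokesRegularity.Theorems.PoloidalWindowDoorPoloidalWindowRigidityZShockSliceTyping

end
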